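import Mathlib
import HarnessLib
import Literature.MathematicalPhysics.QuantumLattice.FermiRG.FST3FST2Bridge
import Literature.MathematicalPhysics.QuantumLattice.HubbardFermiPolar
import Summits.HubbardSuperconductivity.HubbardSuperconductivity.Theorems.KLProgrammeFermiSurfaceFSTInversionClass
import Summits.HubbardSuperconductivity.HubbardSuperconductivity.Theorems.KLProgrammeFermiSurfaceFST2Constants
import Summits.HubbardSuperconductivity.HubbardSuperconductivity.Theorems.KLProgrammeFermiSurfaceWindow

/-!
# Route `KLProgramme` (cruxes K3/K1, risk r2): the Feldman–Salmhofer–Trubowitz III hypotheses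
# (H1)–(H5), (Sy) and the constants `Admits`, AS TYPED over `FST3.Model 2` in `FermiRG/FST3Main.lean`,
# for ANY model record carrying the Hubbard band — (H1)–(H4), (Sy), `Admits` hold; (H5) iff `μ < -2`

Cell `gate-hubbard-kl`, seat fs-1, risk-register item r2 «Fermi-surface hypotheses at `δ ∈ [0.10, 0.20]`».
`FermiRG/FST3Main.lean` (typer t5) states FST III's hypotheses over a model RECORD `M : FST3.Model 2`
(`Γ#`, `𝓕`, `e`, `v̂`) and Theorems 1.1/1.2 as schemas consuming `H1 2 h M`, `H2 2 h M`, `H3 M`, `Sy M` /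
`H4 M`, `H5 M`, `Admits M c`; the dictionary file `FST3FST2Bridge.lean` transports only (H3) and (Sy) to the
FST II predicates instantiated in `KLProgrammeFermiSurfaceFST2*`. Following W-004 («consumers bind
carriers») no Hubbard `Model` record is defined here: every theorem is stated for an ARBITRARY record `M`
whose fields are the Hubbard data — `M.e = fun p ↦ squareDispersion 1 0 p - μ` (and, where needed,
`M.vhat = fun _ ↦ (U : ℂ)`, `M.fund = F` of `Crystal.cubic 2`) — so whichever seat builds the record gets the
hypotheses by `rfl`. For `-4 < μ < 0` we PROVE:

* §1 `Sy M`, `H3 M` (bridge + `klfs_hypSy`/`klfs_hypA3`), `H2 k 0 M` for every `k` (FST III norm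
  `|e|_k ≤ (k+1)² (4+|μ|)` from `KLProgrammeFermiSurfaceFSTInversionClass`, `∇e ≠ 0` on `S`), `H1 k h M` for the
  on-site `v̂ ≡ U` (every `k`, `h`);
* §2 `H5 M ↔ HypA5 ↔ μ < -2` for the cell of `Crystal.cubic 2` — (H5) FAILS on both programme windows, so
  FST III Theorem 1.1 (i) (`theorem11_i`, hypotheses incl. (H5)) is not instantiable there, exactly like
  FST IV's class (`KLProgrammeFermiSurfaceFSTInversion`);
* §3 **(H4) holds** (`klfs_fst3_h4`): two points of the periodic Fermi surface with opposite unit normals are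
  `q = -p + γ`, `γ ∈ 2πℤ²` (`klfs_antipode_eq_neg_add`: cell reduction + Gauss-map injectivity
  `klfs_parallel_gradients`), so along any pair of curves of antipodes `a(t) + γ(t)` is `2πℤ²`-valued, hence
  locally constant where both are differentiable, and `|1 - |a'|/|γ'|| = 0 ≤ 1/8`;
* §4 `Admits M ⟨0, normE, normV, g₀, r₀, w₀⟩` for `-8/3 < μ < 0` with `normE ≥ 9(4+|μ|)`, `normV ≥ |U|`,
  `0 < r₀ ≤ -μ/2`, `0 < g₀ < √((-μ/2)(4+3μ/2))`, `0 < w₀ ≤ -μ/4` (`klfs_fst3_admits`, from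
  `KLProgrammeFermiSurfaceFST2Constants`);
* §5 hence the hypotheses of FST III **Theorem 1.2** (`theorem12`: (H1)_{2,0}, (H2)_{2,0}, (H3), (H4) — no
  (H5)) hold for the Hubbard record at every `-4 < μ < 0`, in particular on both windows, and the typed schema
  yields its conclusion for the Hubbard band CONDITIONALLY on the fact of record (`klfs_fst3_theorem12_hubbard`).

No definitions; everything PROVED. [folklore]
-/

noncomputable section

open Real Set Filter
open scoped Topology

-- the tree's namespace `Summit.<Summit>.<Problem>.Theorems` repeats the summit name by design (D-0017)
set_option linter.dupNamespace false

namespace Summit.HubbardSuperconductivity.HubbardSuperconductivity.Theorems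

open Literature.MathematicalPhysics.QuantumLattice

/-! ### §1 (Sy), (H3), (H2)_{k,0}, (H1)_{k,h} -/

/-- **(Sy)** for any model record carrying the Hubbard band. [folklore] -/
theorem klfs_fst3_sy {μ : ℝ} (M : FermiRG.FST3.Model 2)
    (he : M.e = fun p : Momentum => squareDispersion 1 0 p - μ) : FermiRG.FST3.Sy M := by
  rw [FermiRG.FST3.sy_iff_hypSy, he]
  exact klfs_hypSy μ

/-- **(H3)** (strictly positive curvature, Fermi-sea-convex orientation) for any record carrying the Hubbard
band, `-4 < μ < 0`. [folklore] -/
theorem klfs_fst3_h3 {μ : ℝ} (hμ₁ : -4 < μ) (hμ₂ : μ < 0) (M : FermiRG.FST3.Model 2)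
    (he : M.e = fun p : Momentum => squareDispersion 1 0 p - μ) : FermiRG.FST3.H3 M := by
  rw [FermiRG.FST3.h3_iff_hypA3, he]
  exact klfs_hypA3 hμ₁ hμ₂

/-- **(H2)_{k,0}** for every `k`: `e ∈ C^{k,0}(𝓑, ℝ)` in FST III's norm (`|e|_k ≤ (k+1)² (4+|μ|)`) and
`∇e ≠ 0` on `S` (`-4 < μ < 0`). [folklore] -/
theorem klfs_fst3_h2 {μ : ℝ} (hμ₁ : -4 < μ) (hμ₂ : μ < 0) (M : FermiRG.FST3.Model 2)
    (he : M.e = fun p : Momentum => squareDispersion 1 0 p - μ) (k : ℕ) : FermiRG.FST3.H2 k 0 M := by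
  refine ⟨?_, fun p hp => ?_⟩
  · rw [he]
    exact ⟨klfs_contDiff_e μ, _, klfs_fst4_ckHolderNormLE μ k⟩
  · rw [FermiRG.FST3.fermiSurface_eq, he] at hp
    rw [he]
    exact klfs_gradient_e_ne_zero hμ₁ hμ₂ hp

/-- **(H1)_{k,h}** for the on-site interaction `v̂ ≡ U` (any `k`, any `h`): a constant is `C^{k,h}` with
`|U|_{k,h} = |U|`, satisfies `v̂(-p₀, 𝐩) = conj v̂(p₀, 𝐩)` (real), and is its own `p₀ → ∞` limit with zero
remainder. [folklore] -/
theorem klfs_fst3_h1 (M : FermiRG.FST3.Model 2) {U : ℝ} (hv : M.vhat = fun _ => (U : ℂ)) (k : ℕ) (h : ℝ) :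
    FermiRG.FST3.H1 k h M := by
  refine ⟨?_, fun q => ?_, fun _ => U, fun _ _ _ => rfl, ⟨contDiff_const, _, klfs_ckHolderNormLE_const k h U⟩,
    1, 1, 1, one_pos, one_pos, one_pos, fun q _ => ?_⟩
  · rw [hv]; exact ⟨contDiff_const, _, klfs_ckHolderNormLE_const k h (U : ℂ)⟩
  · rw [hv]; simp
  · rw [hv]
    simp only [sub_self, norm_zero]
    positivity

/-! ### §2 (H5) iff (A5) iff `μ < -2` -/

/-- For a record with the cell of `Crystal.cubic 2`, FST III's (H5) is FST II's (A5) (`FermiRG.HypA5`).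
[folklore] -/
theorem klfs_fst3_h5_iff_hypA5 (M : FermiRG.FST3.Model 2)
    (hF : M.fund = (FermiRG.Crystal.cubic 2).fundamentalDomain) :
    FermiRG.FST3.H5 M ↔ FermiRG.HypA5 (FermiRG.Crystal.cubic 2) M.e := by
  unfold FermiRG.FST3.H5 FermiRG.HypA5
  rw [FermiRG.FST3.fermiSurface_eq, hF]
  constructor
  · intro h5 p hp q hq u v hu hv
    have hu' : u ∈ ({1, -1} : Set ℝ) := by rcases hu with rfl | rfl <;> simp
    have hv' : v ∈ ({1, -1} : Set ℝ) := by rcases hv with rfl | rfl <;> simp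
    exact h5 p hp.1 q hq.1 hp.2 hq.2 u hu' v hv'
  · intro h5 p hp q hq hpF hqF u hu v hv
    have hu' : u = 1 ∨ u = -1 := by simpa using hu
    have hv' : v = 1 ∨ v = -1 := by simpa using hv
    exact h5 p ⟨hp, hpF⟩ q ⟨hq, hqF⟩ u v hu' hv'

/-- **(H5) for the Hubbard record (cell of `Crystal.cubic 2`) iff `μ < -2`** (`-4 ≤ μ < 0`): FST III's
filling restriction «`n < 0.369`». [folklore] -/
theorem klfs_fst3_h5_iff {μ : ℝ} (hμ₁ : -4 ≤ μ) (hμ₂ : μ < 0) (M : FermiRG.FST3.Model 2)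
    (he : M.e = fun p : Momentum => squareDispersion 1 0 p - μ)
    (hF : M.fund = (FermiRG.Crystal.cubic 2).fundamentalDomain) : FermiRG.FST3.H5 M ↔ μ < -2 := by
  rw [klfs_fst3_h5_iff_hypA5 M hF, he]
  exact klfs_hypA5_iff hμ₁ hμ₂

/-- **(H5) FAILS on both programme windows** (`μ ∈ [-0.4267, -0.1798]`, `μ ∈ [-1, -0.15]`): FST III
Theorem 1.1 (i) (`theorem11_i`) is not instantiable there. [folklore] -/
theorem klfs_windows_fst3_not_h5 {μ : ℝ} (hμ : μ ∈ Icc (-0.4267 : ℝ) (-0.1798) ∨ μ ∈ Icc (-1 : ℝ) (-0.15))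
    (M : FermiRG.FST3.Model 2) (he : M.e = fun p : Momentum => squareDispersion 1 0 p - μ)
    (hF : M.fund = (FermiRG.Crystal.cubic 2).fundamentalDomain) : ¬ FermiRG.FST3.H5 M := by
  rw [klfs_fst3_h5_iff_hypA5 M hF, he]
  exact klfs_windows_not_hypA5 hμ

/-! ### §3 (H4): antipodes on the periodic Fermi surface are `-p` modulo `2πℤ²` -/

/-- Non-zero vectors of `2πℤ²` have norm `≥ 2π`. [folklore] -/
theorem klfs_dualLattice_norm_ge {γ : Momentum} (hγ : γ ∈ (FermiRG.Crystal.cubic 2).dualLattice)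
    (hne : γ ≠ 0) : 2 * π ≤ ‖γ‖ := by
  obtain ⟨n0, h0⟩ := klfs_dualLattice_coord hγ 0
  obtain ⟨n1, h1⟩ := klfs_dualLattice_coord hγ 1
  have key : ∀ (i : Fin 2) (n : ℤ), γ i = 2 * π * n → n ≠ 0 → 2 * π ≤ ‖γ‖ := by
    intro i n hi hn
    have h1le : (1 : ℝ) ≤ |(n : ℝ)| := by
      rw [← Int.cast_abs]; exact_mod_cast Int.one_le_abs hn
    calc 2 * π ≤ 2 * π * |(n : ℝ)| := by nlinarith [Real.pi_pos]
      _ = ‖γ i‖ := by rw [Real.norm_eq_abs, hi, abs_mul, abs_of_pos Real.two_pi_pos]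
      _ ≤ ‖γ‖ := PiLp.norm_apply_le γ i
  by_cases hn0 : n0 = 0
  · refine key 1 n1 h1 fun hn1 => hne ?_
    ext i
    fin_cases i
    · simpa [hn0] using h0
    · simpa [hn1] using h1
  · exact key 0 n0 h0 hn0

/-- Translation by `Γ#` does not change `sin pᵢ`. [folklore] -/
theorem klfs_sin_add_dualLattice {γ : Momentum} (hγ : γ ∈ (FermiRG.Crystal.cubic 2).dualLattice)
    (x : Momentum) (i : Fin 2) : Real.sin ((x + γ) i) = Real.sin (x i) := by
  obtain ⟨n, hn⟩ := klfs_dualLattice_coord hγ i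
  rw [PiLp.add_apply, hn, show x i + 2 * π * (n : ℝ) = x i + n * (2 * π) by ring, Real.sin_add_int_mul_two_pi]

/-- A point of the cell `F = [-π,π)²` has sup norm `≤ π`. [folklore] -/
theorem klfs_supNorm_le_pi_of_mem_cell {z : Momentum} (hz : z ∈ (FermiRG.Crystal.cubic 2).fundamentalDomain) :
    ‖WithLp.ofLp z‖ ≤ π := by
  rw [pi_norm_le_iff_of_nonneg Real.pi_pos.le]
  intro i
  have h := (klfs_mem_cubic_fundamentalDomain.1 hz) i
  rw [Real.norm_eq_abs]
  exact abs_le.2 ⟨h.1, h.2.le⟩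

/-- **Antipodes are `-p` modulo `2πℤ²`.** If `p, q` lie on the periodic Fermi surface of `e = ε - μ`
(`-4 < μ < 0`) and their unit normals are opposite (`|∇e(p)| ∇e(q) = -|∇e(q)| ∇e(p)`, FST III's antipode
relation), then `q = -p + γ` for some `γ ∈ 2πℤ²`: reduce both to the cell, where the curve is the polar
graph `fermiPolar μ`, and use the injectivity of the Gauss map modulo the central symmetry
(`klfs_parallel_gradients`); the same-normal alternative would force `∇e(p) = 0`. [folklore] -/
theorem klfs_antipode_eq_neg_add {μ : ℝ} (hμ₁ : -4 < μ) (hμ₂ : μ < 0) {p q : Momentum}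
    (hp : squareDispersion 1 0 p - μ = 0) (hq : squareDispersion 1 0 q - μ = 0)
    (hn : ‖gradient (fun z : Momentum => squareDispersion 1 0 z - μ) p‖ •
        gradient (fun z : Momentum => squareDispersion 1 0 z - μ) q =
      -(‖gradient (fun z : Momentum => squareDispersion 1 0 z - μ) q‖ •
        gradient (fun z : Momentum => squareDispersion 1 0 z - μ) p)) :
    ∃ γ ∈ (FermiRG.Crystal.cubic 2).dualLattice, q = -p + γ := by
  set Np := ‖gradient (fun z : Momentum => squareDispersion 1 0 z - μ) p‖ with hNp
  set Nq := ‖gradient (fun z : Momentum => squareDispersion 1 0 z - μ) q‖ with hNq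
  have hNp0 : 0 < Np := norm_pos_iff.2 (klfs_gradient_e_ne_zero hμ₁ hμ₂ (klfs_mem_fermiSurface_iff.2 (by linarith)))
  have hNq0 : 0 < Nq := norm_pos_iff.2 (klfs_gradient_e_ne_zero hμ₁ hμ₂ (klfs_mem_fermiSurface_iff.2 (by linarith)))
  -- the antipode relation in coordinates
  rw [klfs_gradient_level μ q, klfs_gradient_level μ p, gradient_squareDispersion, gradient_squareDispersion] at hn
  have hn0 : Np * (2 * Real.sin (q 0)) = -(Nq * (2 * Real.sin (p 0))) := by
    have := congrArg (fun v : Momentum => v 0) hn; simpa using this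
  have hn1 : Np * (2 * Real.sin (q 1)) = -(Nq * (2 * Real.sin (p 1))) := by
    have := congrArg (fun v : Momentum => v 1) hn; simpa using this
  -- cell representatives
  obtain ⟨gp, hgp, -⟩ := (FermiRG.Crystal.cubic 2).existsUnique_rep p
  obtain ⟨gq, hgq, -⟩ := (FermiRG.Crystal.cubic 2).existsUnique_rep q
  have hsp : ∀ i, Real.sin ((p + (gp : Momentum)) i) = Real.sin (p i) := klfs_sin_add_dualLattice gp.2 p
  have hsq : ∀ i, Real.sin ((q + (gq : Momentum)) i) = Real.sin (q i) := klfs_sin_add_dualLattice gq.2 q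
  have hlev : ∀ (x : Momentum) (g : (FermiRG.Crystal.cubic 2).dualLattice), squareDispersion 1 0 x - μ = 0 →
      sqDispersion (WithLp.ofLp (x + (g : Momentum))) = μ := by
    intro x g hx
    have hper := klfs_isLatticePeriodic_e μ (g : Momentum) g.2 x
    beta_reduce at hper
    rw [← squareDispersion_one_zero_eq_sqDispersion]; linarith
  obtain ⟨θ, -, hθ⟩ := exists_fermiPolar_eq hμ₁ hμ₂ (klfs_supNorm_le_pi_of_mem_cell hgp) (hlev p gp hp)
  obtain ⟨φ, -, hφ⟩ := exists_fermiPolar_eq hμ₁ hμ₂ (klfs_supNorm_le_pi_of_mem_cell hgq) (hlev q gq hq)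
  have hX : ∀ ψ, fermiPolar μ ψ 0 = bandX μ ψ := fun ψ => fermiPolar_apply_zero μ ψ
  have hY : ∀ ψ, fermiPolar μ ψ 1 = bandY μ ψ := fun ψ => fermiPolar_apply_one μ ψ
  have hp0 : Real.sin (bandX μ θ) = Real.sin (p 0) := by rw [← hX, hθ, hsp]
  have hp1 : Real.sin (bandY μ θ) = Real.sin (p 1) := by rw [← hY, hθ, hsp]
  have hq0 : Real.sin (bandX μ φ) = Real.sin (q 0) := by rw [← hX, hφ, hsq]
  have hq1 : Real.sin (bandY μ φ) = Real.sin (q 1) := by rw [← hY, hφ, hsq]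
  -- the gradients are parallel
  have hcross : Real.sin (bandX μ θ) * Real.sin (bandY μ φ) - Real.sin (bandY μ θ) * Real.sin (bandX μ φ) = 0 := by
    rw [hp0, hp1, hq0, hq1]
    have h : Np * (Real.sin (p 0) * Real.sin (q 1) - Real.sin (p 1) * Real.sin (q 0)) = 0 := by
      linear_combination (Real.sin (p 0) / 2) * hn1 - (Real.sin (p 1) / 2) * hn0
    rcases mul_eq_zero.1 h with h | h
    · exact absurd h hNp0.ne'
    · exact h
  obtain ⟨σ, hσ, hσX, hσY⟩ := klfs_parallel_gradients hμ₁ hμ₂ hcross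
  rcases hσ with rfl | rfl
  · -- same normal: then `sin p₀ = sin p₁ = 0`, contradicting `∇e(p) ≠ 0`
    exfalso
    rw [one_mul] at hσX hσY
    have hs0 : Real.sin (q 0) = Real.sin (p 0) := by rw [← hq0, hσX, hp0]
    have hs1 : Real.sin (q 1) = Real.sin (p 1) := by rw [← hq1, hσY, hp1]
    rw [hs0] at hn0
    rw [hs1] at hn1
    have h0 : Real.sin (p 0) = 0 := by nlinarith
    have h1 : Real.sin (p 1) = 0 := by nlinarith
    have : gradient (squareDispersion 1 0) p = 0 := by
      rw [gradient_squareDispersion]; ext i; fin_cases i <;> simp [h0, h1]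
    exact klfs_gradient_e_ne_zero hμ₁ hμ₂ (klfs_mem_fermiSurface_iff.2 (by linarith : squareDispersion 1 0 p = μ))
      (by rw [klfs_gradient_level]; exact this)
  · -- opposite points in the cell: `q + gq = -(p + gp)`
    have hqp : q + (gq : Momentum) = -(p + (gp : Momentum)) := by
      rw [← hφ, ← hθ]
      ext i
      fin_cases i
      · show fermiPolar μ φ 0 = (-fermiPolar μ θ) 0
        rw [PiLp.neg_apply, hX, hX, hσX, neg_one_mul]
      · show fermiPolar μ φ 1 = (-fermiPolar μ θ) 1
        rw [PiLp.neg_apply, hY, hY, hσY, neg_one_mul]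
    refine ⟨-(gp : Momentum) - (gq : Momentum), Submodule.sub_mem _ (Submodule.neg_mem _ gp.2) gq.2, ?_⟩
    have := congrArg (fun v => v - (gq : Momentum)) hqp
    simp only [add_sub_cancel_right] at this
    rw [this]; abel

/-- **(H4) for any record carrying the Hubbard band** (`-4 < μ < 0`): along two curves `γ`, `a` of
antipodes, `a(t) + γ(t) ∈ 2πℤ²` for all `t`; where both are differentiable the sum is continuous, hence
locally constant (non-zero lattice vectors have norm `≥ 2π`), so `a'(t) = -γ'(t)` and
`|1 - |a'(t)|/|γ'(t)|| = 0 ≤ 1/8` — FST II/III: «if `e` is symmetric, (H4) holds trivially». [folklore] -/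
theorem klfs_fst3_h4 {μ : ℝ} (hμ₁ : -4 < μ) (hμ₂ : μ < 0) (M : FermiRG.FST3.Model 2)
    (he : M.e = fun p : Momentum => squareDispersion 1 0 p - μ) : FermiRG.FST3.H4 M := by
  intro γ a hanti t hγd had hγ'
  have hΛ : ∀ s, a s + γ s ∈ (FermiRG.Crystal.cubic 2).dualLattice := by
    intro s
    obtain ⟨h1, h2, h3⟩ := hanti s
    simp only [he] at h1 h2 h3
    obtain ⟨g, hg, hq⟩ := klfs_antipode_eq_neg_add hμ₁ hμ₂ h1 h2 h3
    rw [hq, neg_add_cancel_comm]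
    exact hg
  have hcont : ContinuousAt (fun s => a s + γ s) t := (had.add hγd).continuousAt
  have hev : (fun s => a s + γ s) =ᶠ[𝓝 t] fun _ => a t + γ t := by
    have hball : ∀ᶠ s in 𝓝 t, a s + γ s ∈ Metric.ball (a t + γ t) (2 * π) :=
      hcont.preimage_mem_nhds (Metric.ball_mem_nhds _ Real.two_pi_pos)
    filter_upwards [hball] with s hs
    by_contra hne
    have hge := klfs_dualLattice_norm_ge (Submodule.sub_mem _ (hΛ s) (hΛ t)) (sub_ne_zero.2 hne)
    rw [Metric.mem_ball, dist_eq_norm] at hs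
    linarith
  have hderiv0 : HasDerivAt (fun s => a s + γ s) 0 t :=
    (hasDerivAt_const t (a t + γ t)).congr_of_eventuallyEq hev
  have hsum : HasDerivAt (fun s => a s + γ s) (deriv a t + deriv γ t) t := had.hasDerivAt.add hγd.hasDerivAt
  have h0 : deriv a t + deriv γ t = 0 := hsum.unique hderiv0
  have ha : deriv a t = -deriv γ t := eq_neg_of_add_eq_zero_left h0
  rw [ha, norm_neg, div_self (norm_ne_zero_iff.2 hγ'), sub_self, abs_zero]
  norm_num

/-! ### §4 The constants: `Admits M c` -/

/-- **`Admits M ⟨0, normE, normV, g₀, r₀, w₀⟩` for the Hubbard record** (`-8/3 < μ < 0`, on-site `v̂ ≡ U`)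
whenever `normE ≥ 9 (4 + |μ|)`, `normV ≥ |U|`, `0 < r₀ ≤ -μ/2`, `0 < g₀ < √((-μ/2)(4 + 3μ/2))`,
`0 < w₀ ≤ -μ/4`: FST III's `|e|₂`, `|v̂|₂` and the consequences (1), (3) of (H2)/(H3) on the neighbourhood
`U_{r₀} = {|e| < r₀}` (`klfs_norm_gradient_ge_near`, `klfs_hessQuad_ge_near`). [folklore] -/
theorem klfs_fst3_admits {μ : ℝ} (hμ₁ : -8 / 3 < μ) (hμ₂ : μ < 0) (M : FermiRG.FST3.Model 2)
    (he : M.e = fun p : Momentum => squareDispersion 1 0 p - μ) {U : ℝ} (hv : M.vhat = fun _ => (U : ℂ))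
    {normE normV g₀ r₀ w₀ : ℝ} (hE : 9 * (4 + |μ|) ≤ normE) (hV : |U| ≤ normV) (hr₀ : 0 < r₀)
    (hr : r₀ ≤ -μ / 2) (hg₀ : 0 < g₀) (hg : g₀ < Real.sqrt (-μ / 2 * (4 + 3 * μ / 2))) (hw₀ : 0 < w₀)
    (hw : w₀ ≤ -μ / 4) :
    FermiRG.FST3.Admits M ⟨0, normE, normV, g₀, r₀, w₀⟩ := by
  refine ⟨?_, ?_, hr₀, hg₀, hw₀, fun p hp => ?_, fun p hp t ht => ?_⟩
  · rw [he]
    have h := klfs_fst4_ckHolderNormLE μ 2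
    exact h.mono (by norm_num at h ⊢; linarith)
  · rw [hv]
    exact (klfs_ckHolderNormLE_const 2 0 (U : ℂ)).mono (by rwa [Complex.norm_real, Real.norm_eq_abs])
  · rw [he] at hp ⊢
    exact hg.trans_le (klfs_norm_gradient_ge_near hμ₁ hμ₂ (hp.trans_le hr))
  · rw [he] at hp ht ⊢
    change w₀ * ‖t‖ ^ 2 ≤ FermiRG.hessQuad (fun q : Momentum => squareDispersion 1 0 q - μ) p t
    rw [real_inner_comm] at ht
    exact (mul_le_mul_of_nonneg_right hw (sq_nonneg _)).trans (klfs_hessQuad_ge_near hμ₁ hμ₂ (hp.trans_le hr) ht)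

/-- **Window-uniform constants**: on the certified window `μ ∈ [-0.4267, -0.1798]` ONE regularity datum serves
every level — `Admits M ⟨0, 40, normV, 0.578, 0.0899, 0.0449⟩` for any record carrying the band and `v̂ ≡ U` with
`|U| ≤ normV` (from `klfs_window_geomConstants`: `|e|₂`-type bound `9 (4 + |μ|) ≤ 40`, `|∇e| ≥ 0.579 > 0.578` and
`(t, e''t) ≥ 0.0449 |t|²` on `{|e| < 0.0899}`), so FST III's constants `𝓒ᵢ(h, |e|_{2,h}, |v̂|_{2,h}, g₀, r₀, w₀)` are
`μ`-uniform on the window. [folklore] -/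
theorem klfs_window_fst3_admits {μ : ℝ} (hμ : μ ∈ Icc (-0.4267 : ℝ) (-0.1798)) (M : FermiRG.FST3.Model 2)
    (he : M.e = fun p : Momentum => squareDispersion 1 0 p - μ) {U : ℝ} (hv : M.vhat = fun _ => (U : ℂ))
    {normV : ℝ} (hV : |U| ≤ normV) :
    FermiRG.FST3.Admits M ⟨0, 40, normV, 0.578, 0.0899, 0.0449⟩ := by
  have hG := klfs_window_geomConstants hμ
  refine ⟨?_, ?_, by norm_num, by norm_num, by norm_num, fun p hp => ?_, fun p hp t ht => ?_⟩
  · rw [he]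
    have h := klfs_fst4_ckHolderNormLE μ 2
    refine h.mono ?_
    rw [abs_of_neg (by linarith [hμ.2])]
    norm_num
    linarith [hμ.1]
  · rw [hv]
    exact (klfs_ckHolderNormLE_const 2 0 (U : ℂ)).mono (by rwa [Complex.norm_real, Real.norm_eq_abs])
  · rw [he] at hp ⊢
    exact lt_of_lt_of_le (by norm_num) (hG.le_norm_gradient p hp)
  · rw [he] at hp ht ⊢
    change (0.0449 : ℝ) * ‖t‖ ^ 2 ≤ FermiRG.hessQuad (fun q : Momentum => squareDispersion 1 0 q - μ) p t
    rw [real_inner_comm] at ht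
    exact hG.le_hessQuad p hp t ht

/-! ### §5 The hypothesis sets of FST III's theorems, on the windows -/

/-- **The hypotheses of FST III Theorem 1.2** — (H1)_{2,0}, (H2)_{2,0}, (H3), (H4) — **hold for any record
carrying the Hubbard band and the on-site interaction**, at every `-4 < μ < 0` (so on both windows), while
the filling restriction (H5) of Theorem 1.1 (i) holds iff `μ < -2`. [folklore] -/
theorem klfs_fst3_theorem12_hypotheses {μ : ℝ} (hμ₁ : -4 < μ) (hμ₂ : μ < 0) (M : FermiRG.FST3.Model 2)
    (he : M.e = fun p : Momentum => squareDispersion 1 0 p - μ) {U : ℝ} (hv : M.vhat = fun _ => (U : ℂ)) :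
    FermiRG.FST3.H1 2 0 M ∧ FermiRG.FST3.H2 2 0 M ∧ FermiRG.FST3.H3 M ∧ FermiRG.FST3.H4 M :=
  ⟨klfs_fst3_h1 M hv 2 0, klfs_fst3_h2 hμ₁ hμ₂ M he 2, klfs_fst3_h3 hμ₁ hμ₂ M he, klfs_fst3_h4 hμ₁ hμ₂ M he⟩

/-- **FST III Theorem 1.2 for the Hubbard band, CONDITIONAL on the typed fact**: if `FST3.theorem12 2 Σ`
holds for a self-energy binder `Σ` (FST I's coefficients; GAP G-t5-1), then for every record `M` carrying the
Hubbard band and the on-site interaction at `-4 < μ < 0` (e.g. on the Kohn–Luttinger window), all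
`Σ_r(M)`, `r ≥ 1`, are `C^{1,γ}` for every `0 ≤ γ < 1`. Nothing is asserted about `Σ`. [folklore] -/
theorem klfs_fst3_theorem12_hubbard {Sigma : FermiRG.FST3.SelfEnergy 2} (hT : FermiRG.FST3.theorem12 2 Sigma)
    {μ : ℝ} (hμ₁ : -4 < μ) (hμ₂ : μ < 0) (M : FermiRG.FST3.Model 2)
    (he : M.e = fun p : Momentum => squareDispersion 1 0 p - μ) {U : ℝ} (hv : M.vhat = fun _ => (U : ℂ))
    {γ : ℝ} (hγ₀ : 0 ≤ γ) (hγ₁ : γ < 1) {r : ℕ} (hr : 1 ≤ r) :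
    FermiRG.FST3.IsCkHolder 1 γ (Sigma M r) := by
  obtain ⟨h1, h2, h3, h4⟩ := klfs_fst3_theorem12_hypotheses hμ₁ hμ₂ M he hv
  exact (hT le_rfl).2 M h1 h2 h3 h4 γ hγ₀ hγ₁ r hr

end Summit.HubbardSuperconductivity.HubbardSuperconductivity.Theorems

end
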